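import Mathlib
import Summits.Ventures.HodgeRepro.Tier4.Line4.ConvProduct
import Summits.Ventures.HodgeRepro.Tier4.Line4.ProductWitness
import Summits.Ventures.HodgeRepro.Tier4.Line4.SuppMeasure
import Summits.Ventures.HodgeRepro.Tier4.Line4.ConvLevelWitness

/-!
# Tier4/Line4/LevelIndicator — the witness of record under plan-4 g5's unit ruling (γ) S15319: the plain level
double-coset indicator `levelDC`, the group-normalised witness `ffinMu`, their convolution with the level indicator, and
the main term in the unit `suppMeasure N γ₀`

Blind re-derivation cell `pub-hodge-repro`, Tier 4 «prove the step» (README §9–§10), seat t4-L2-p1 (gen 3; plan-4 g5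
S15319 «L2-p1 — the convolution identity `convFin (ffinMu μ₀ γ₀ N) (levelInd N) = 1_{K(N)γ₀K(N)}` and the indicator form of
L112 (`main ≥ δ · suppMeasure N γ₀`)»).  Tree path `lean/Summits/Ventures/HodgeRepro/Tier4/Line4/LevelIndicator.lean`.
Imports `Line4/ConvLevelWitness` (p706242), `Line4/SuppMeasure` (p704106), `Line4/ConvProduct` (p697081), `Line4/ProductWitness`
(p704125).  Mathlib-level.

THE OBJECTS.  `levelDC W γ₀ N x := 1[x_f ∈ K(N) γ₀,f K(N)]` (the plain double-coset indicator of the finite coordinate; sup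
`1`, real, non-negative, right-`K(N)`-invariant on `G(𝔸_f)`; `ffinLevel = levelNorm⁻¹ • levelDC`), and
`ffinMu W μ₀ γ₀ N := (μ₀(K(N)))⁻¹ • levelDC W γ₀ N` for one fixed Haar measure `μ₀` of `G(𝔸_f)` — the witness of record (γ).

THE STATEMENTS.  `convFin_levelDC_levelInd`: `convFin μ₀ (levelDC N) (levelInd N) x = μ₀(K(N)) · levelDC N x`;
**`convFin_ffinMu_levelInd`: `convFin μ₀ (ffinMu μ₀ N) (levelInd N) = levelDC N`** EXACTLY (`N ≠ 0`: `0 < μ₀(K(N)) < ∞`) — so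
the convolution family `(finf ⊗ ffinMu N) ⋆ (e ⊗ 1_{K(N)})` has the PLAIN indicator `levelDC N` as its finite factor (sup `O(1)`,
no rescaling); **`re_setIntegral_chi_innerFin_levelDC_ge_suppMeasure`**: the finite main term of `levelDC N` is
`≥ δ · suppMeasure N γ₀` — the `hmain` of the level-measure assembly in the unit of record
`v N := c · (suppMeasure N γ₀).toReal` (the indicator form of SuppMeasure L112; no `levelNorm` anywhere).

Nothing here says anything about the status of the Hodge conjecture for CM abelian varieties, which is NOT proved
(HC_CM is NOT proved by anyone in this repository).
-/

set_option autoImplicit false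
noncomputable section
namespace Summit.Ventures.HodgeRepro.Tier4.Line4
open Summit.Ventures.HodgeRepro.Tier4 Summit.Ventures.HodgeRepro.Tier4.Common
  Summit.Ventures.HodgeRepro.Tier4.Line1 MeasureTheory
open scoped ComplexConjugate Topology Pointwise NNReal ENNReal

section DC
variable {k : Type} [Field k] [NumberField k] (W : PlaneData k) (γ₀ : GA W) (N : ℕ)

/-- **The plain level double-coset indicator of the finite coordinate**: `levelDC N x = 1` iff `x_f ∈ K(N) γ₀,f K(N)`. -/
def levelDC (x : GA W) : ℂ :=
  (levelDoubleCoset W N (GA.ofFinPart W γ₀)).indicator (fun _ => (1 : ℂ)) (GA.ofFinPart W x)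

/-- `levelDC` is real. -/
theorem levelDC_im (x : GA W) : (levelDC W γ₀ N x).im = 0 := by
  unfold levelDC
  by_cases h : GA.ofFinPart W x ∈ levelDoubleCoset W N (GA.ofFinPart W γ₀)
  · rw [Set.indicator_of_mem h, Complex.one_im]
  · rw [Set.indicator_of_notMem h, Complex.zero_im]

/-- `levelDC` is non-negative. -/
theorem levelDC_re_nonneg (x : GA W) : 0 ≤ (levelDC W γ₀ N x).re := by
  unfold levelDC
  by_cases h : GA.ofFinPart W x ∈ levelDoubleCoset W N (GA.ofFinPart W γ₀)
  · rw [Set.indicator_of_mem h, Complex.one_re]; exact zero_le_one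
  · rw [Set.indicator_of_notMem h, Complex.zero_re]

/-- `levelDC` depends on `x` through its finite part only. -/
theorem levelDC_ofFinPart (x : GA W) : levelDC W γ₀ N (GA.ofFinPart W x) = levelDC W γ₀ N x := by
  unfold levelDC
  rw [ofFinPart_eq_self_of_mem_finitePart W (ofFinPart_mem_finitePart W x)]

/-- On `G(𝔸_f)`, `levelDC ≠ 0` only on the double coset. -/
theorem mem_levelDoubleCoset_of_levelDC_ne_zero {g : GA W} (hg : g ∈ finitePart W) (h : levelDC W γ₀ N g ≠ 0) :
    g ∈ levelDoubleCoset W N (GA.ofFinPart W γ₀) := by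
  unfold levelDC at h
  rw [ofFinPart_eq_self_of_mem_finitePart W hg] at h
  by_contra hmem
  exact h (by rw [Set.indicator_of_notMem hmem])

/-- `levelDC = 1` on the double coset (for `g ∈ G(𝔸_f)`). -/
theorem levelDC_of_mem {g : GA W} (hg : g ∈ finitePart W) (h : g ∈ levelDoubleCoset W N (GA.ofFinPart W γ₀)) :
    levelDC W γ₀ N g = 1 := by
  unfold levelDC
  rw [ofFinPart_eq_self_of_mem_finitePart W hg, Set.indicator_of_mem h]

/-- `levelDC` is right-`K(N)`-invariant on `G(𝔸_f)`. -/
theorem levelDC_mul_of_mem {g κ : GA W} (hg : g ∈ finitePart W) (hκ : κ ∈ levelK W N) :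
    levelDC W γ₀ N (g * κ) = levelDC W γ₀ N g := by
  have hgκ : g * κ ∈ finitePart W := (finitePart W).mul_mem hg (levelK_le_finitePart W N hκ)
  unfold levelDC
  rw [ofFinPart_eq_self_of_mem_finitePart W hg, ofFinPart_eq_self_of_mem_finitePart W hgκ]
  by_cases h : g ∈ levelDoubleCoset W N (GA.ofFinPart W γ₀)
  · rw [Set.indicator_of_mem h, Set.indicator_of_mem (levelDoubleCoset_mul_mem W γ₀ N h hκ)]
  · have h' : g * κ ∉ levelDoubleCoset W N (GA.ofFinPart W γ₀) := by
      intro h'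
      have := levelDoubleCoset_mul_mem W γ₀ N h' (inv_mem hκ)
      rw [mul_inv_cancel_right] at this
      exact h this
    rw [Set.indicator_of_notMem h, Set.indicator_of_notMem h']

/-- `levelDC` is continuous (`N ≠ 0`): the indicator of the clopen set `{x | x_f ∈ K(N) γ₀,f K(N)}`. -/
theorem continuous_levelDC (hN : N ≠ 0) : Continuous (levelDC W γ₀ N) := by
  have hind : levelDC W γ₀ N = (GA.ofFinPart W ⁻¹' levelDoubleCoset W N (GA.ofFinPart W γ₀)).indicator
      (fun _ => (1 : ℂ)) := by
    funext x
    unfold levelDC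
    by_cases h : GA.ofFinPart W x ∈ levelDoubleCoset W N (GA.ofFinPart W γ₀)
    · rw [Set.indicator_of_mem h, Set.indicator_of_mem (Set.mem_preimage.2 h)]
    · rw [Set.indicator_of_notMem h, Set.indicator_of_notMem (fun h' => h (Set.mem_preimage.1 h'))]
  rw [hind]
  exact (isClopen_preimage_ofFinPart_levelDoubleCoset W γ₀ N hN).continuous_indicator continuous_const

end DC

section Mu
variable {k : Type} [Field k] [NumberField k] (W : PlaneData k) [MeasurableSpace (GA W)]
  (μ₀ : Measure (finitePart W)) (γ₀ : GA W) (N : ℕ)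

/-- **The group-normalised witness of record (γ)**: `ffinMu μ₀ N := (μ₀(K(N)))⁻¹ • levelDC N`. -/
def ffinMu (x : GA W) : ℂ :=
  (((μ₀ {y : finitePart W | (y : GA W) ∈ levelK W N}).toReal⁻¹ : ℝ) : ℂ) * levelDC W γ₀ N x

/-- `ffinMu` as a scalar multiple of `levelDC`, pointwise. -/
theorem ffinMu_apply (x : GA W) :
    ffinMu W μ₀ γ₀ N x = (((μ₀ {y : finitePart W | (y : GA W) ∈ levelK W N}).toReal⁻¹ : ℝ) : ℂ) * levelDC W γ₀ N x :=
  rfl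

end Mu

section Conv
variable {k : Type} [Field k] [NumberField k] (W : PlaneData k) [MeasurableSpace (GA W)] [BorelSpace (GA W)]
  (γ₀ : GA W) (N : ℕ)

omit [BorelSpace (GA W)] in
/-- `K(N)` has positive finite Haar measure in `G(𝔸_f)` (`N ≠ 0`: compact and open). -/
theorem measure_levelK_pos_lt_top (μ₀ : Measure (finitePart W)) [μ₀.IsHaarMeasure] (hN : N ≠ 0) :
    0 < μ₀ {y : finitePart W | (y : GA W) ∈ levelK W N} ∧ μ₀ {y : finitePart W | (y : GA W) ∈ levelK W N} < ⊤ := by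
  haveI : T2Space (GA W) := t2Space_GA W
  have hopen : IsOpen {y : finitePart W | (y : GA W) ∈ levelK W N} := by
    have : {y : finitePart W | (y : GA W) ∈ levelK W N} = Subtype.val ⁻¹' finCongr W N := by
      ext y
      have h := congrArg (fun S : Set (finitePart W) => y ∈ S) (preimage_levelK_eq W N)
      simp only [Set.mem_preimage, SetLike.mem_coe, eq_iff_iff] at h
      exact h
    rw [this]
    exact (isOpen_finCongr W hN).preimage continuous_subtype_val
  have hcpt : IsCompact {y : finitePart W | (y : GA W) ∈ levelK W N} :=
    (isClosed_finitePart W).isClosedEmbedding_subtypeVal.isCompact_preimage (isCompact_levelK W hN)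
  refine ⟨hopen.measure_pos μ₀ ⟨1, ?_⟩, hcpt.measure_lt_top⟩
  show ((1 : finitePart W) : GA W) ∈ levelK W N
  simp only [OneMemClass.coe_one]
  exact one_mem _

/-- **The finite convolution of the plain indicator with the level indicator**:
`convFin μ₀ (levelDC N) (levelInd N) x = μ₀(K(N)) · levelDC N x`. -/
theorem convFin_levelDC_levelInd (μ₀ : Measure (finitePart W)) [μ₀.IsHaarMeasure] (hN : N ≠ 0) (x : GA W) :
    convFin W μ₀ (levelDC W γ₀ N) (levelInd W N) x =
      (μ₀ {y : finitePart W | (y : GA W) ∈ levelK W N}).toReal * levelDC W γ₀ N x := by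
  haveI : T2Space (GA W) := t2Space_GA W
  haveI : BorelSpace (finitePart W) := Subtype.borelSpace _
  set xf : finitePart W := ⟨GA.ofFinPart W x, ofFinPart_mem_finitePart W x⟩ with hxf
  set K' : Set (finitePart W) := {y | (y : GA W) ∈ levelK W N} with hK'
  have hK'm : MeasurableSet K' :=
    ((isCompact_levelK W hN).isClosed.preimage continuous_subtype_val).measurableSet
  set S : Set (finitePart W) := (fun y : finitePart W => xf⁻¹ * y) ⁻¹' K' with hS
  have hSm : MeasurableSet S := hK'm.preimage (measurable_const_mul xf⁻¹)
  have hint : ∀ y : finitePart W, levelDC W γ₀ N (y : GA W) * levelInd W N ((y : GA W)⁻¹ * GA.ofFinPart W x) =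
      S.indicator (fun _ => levelDC W γ₀ N x) y := by
    intro y
    have hyx : GA.ofFinPart W ((y : GA W)⁻¹ * GA.ofFinPart W x) = (y : GA W)⁻¹ * GA.ofFinPart W x :=
      ofFinPart_eq_self_of_mem_finitePart W ((finitePart W).mul_mem ((finitePart W).inv_mem y.2)
        (ofFinPart_mem_finitePart W x))
    have hmemS : y ∈ S ↔ (y : GA W)⁻¹ * GA.ofFinPart W x ∈ levelK W N := by
      show ((xf⁻¹ * y : finitePart W) : GA W) ∈ levelK W N ↔ _
      rw [Subgroup.coe_mul, Subgroup.coe_inv]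
      constructor
      · intro h
        have := inv_mem h
        rwa [mul_inv_rev, inv_inv] at this
      · intro h
        have := inv_mem h
        rwa [mul_inv_rev, inv_inv] at this
    by_cases hy : y ∈ S
    · have h1 : levelInd W N ((y : GA W)⁻¹ * GA.ofFinPart W x) = 1 :=
        levelInd_eq_one_of_mem W (by rw [hyx]; exact hmemS.1 hy)
      rw [Set.indicator_of_mem hy, h1, mul_one]
      have hx : GA.ofFinPart W x = (y : GA W) * ((y : GA W)⁻¹ * GA.ofFinPart W x) := by group
      rw [← levelDC_ofFinPart W γ₀ N x, hx, levelDC_mul_of_mem W γ₀ N y.2 (hmemS.1 hy)]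
    · have h0 : levelInd W N ((y : GA W)⁻¹ * GA.ofFinPart W x) = 0 :=
        levelInd_eq_zero_of_notMem W (by rw [hyx]; exact fun h => hy (hmemS.2 h))
      rw [Set.indicator_of_notMem hy, h0, mul_zero]
  unfold convFin
  simp_rw [hint]
  rw [integral_indicator hSm, setIntegral_const, Complex.real_smul, measureReal_def, hS,
    measure_preimage_mul μ₀ xf⁻¹ K']

/-- **`ffinMu N ⋆ 1_{K(N)} = levelDC N` EXACTLY** (`N ≠ 0`): the finite factor of the convolution family of record is the plain
double-coset indicator. -/
theorem convFin_ffinMu_levelInd (μ₀ : Measure (finitePart W)) [μ₀.IsHaarMeasure] (hN : N ≠ 0) (x : GA W) :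
    convFin W μ₀ (ffinMu W μ₀ γ₀ N) (levelInd W N) x = levelDC W γ₀ N x := by
  obtain ⟨hpos, hlt⟩ := measure_levelK_pos_lt_top W N μ₀ hN
  have hne : (μ₀ {y : finitePart W | (y : GA W) ∈ levelK W N}).toReal ≠ 0 :=
    (ENNReal.toReal_pos hpos.ne' hlt.ne).ne'
  have hpull : convFin W μ₀ (ffinMu W μ₀ γ₀ N) (levelInd W N) x =
      (((μ₀ {y : finitePart W | (y : GA W) ∈ levelK W N}).toReal⁻¹ : ℝ) : ℂ) *
        convFin W μ₀ (levelDC W γ₀ N) (levelInd W N) x := by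
    unfold convFin
    rw [← integral_const_mul]
    refine integral_congr_ae (Filter.Eventually.of_forall fun y => ?_)
    show ffinMu W μ₀ γ₀ N y * _ = _
    rw [ffinMu_apply, mul_assoc]
  rw [hpull, convFin_levelDC_levelInd W γ₀ N μ₀ hN x, ← mul_assoc, ← Complex.ofReal_mul, inv_mul_cancel₀ hne,
    Complex.ofReal_one, one_mul]

end Conv

section Main
variable {k : Type} [Field k] [NumberField k] (W : PlaneData k) [MeasurableSpace (GA W)] [BorelSpace (GA W)]
  (νf : Measure (torusFin W)) (νf' : Measure (torusFin' W)) (γ₀ : GA W) (DZf : Set (torusFin W)) (R : RTFData W)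

/-- **The finite main term of the plain indicator in the unit of record**: `δ · suppMeasure N γ₀ ≤ Re ∫_{DZ_f} χ(b) I_f(b) dν_f`
for `F_f := levelDC N` (the indicator form of SuppMeasure's L112, no `levelNorm`). -/
theorem re_setIntegral_chi_innerFin_levelDC_ge_suppMeasure [νf.IsHaarMeasure] [νf'.IsHaarMeasure]
    (hc : Continuous R.chi) (hu : ∀ a, ‖R.chi a‖ = 1) (hc' : Continuous R.chi') (hu' : ∀ a, ‖R.chi' a‖ = 1)
    {N : ℕ} (hN : N ≠ 0) (hDZf : MeasurableSet DZf) (δ : ℝ)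
    (hδ : ∀ b ∈ DZf, ∀ b' : torusFin' W,
      levelDC W γ₀ N ((((b : torusT W) : GA W))⁻¹ * GA.ofFinPart W γ₀ * ((b' : torusT' W) : GA W)) ≠ 0 →
      δ ≤ (R.chi b * conj (R.chi' b')).re)
    (hint : IntegrableOn (fun p : torusFin W × torusFin' W => R.chi p.1 * conj (R.chi' p.2) *
      levelDC W γ₀ N ((((p.1 : torusT W) : GA W))⁻¹ * GA.ofFinPart W γ₀ * ((p.2 : torusT' W) : GA W)))
      (DZf ×ˢ Set.univ) (νf.prod νf')) :
    δ * (suppMeasure W νf νf' γ₀ DZf N γ₀).toReal ≤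
      (∫ b in DZf, R.chi b * innerFin W R (levelDC W γ₀ N) γ₀ νf' b ∂νf).re := by
  haveI : BorelSpace (torusT W) := Subtype.borelSpace _
  haveI : BorelSpace (torusT' W) := Subtype.borelSpace _
  haveI : BorelSpace (torusFin W) := Subtype.borelSpace _
  haveI : BorelSpace (torusFin' W) := Subtype.borelSpace _
  haveI : SecondCountableTopology (torusFin W) := secondCountable_torusFin W
  haveI : SecondCountableTopology (torusFin' W) := secondCountable_torusFin' W
  haveI : BorelSpace (torusFin W × torusFin' W) := Prod.borelSpace
  have hmain := re_setIntegral_chi_innerFin_ge W R hc hu hc' hu' νf νf' (levelDC W γ₀ N)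
    (levelDC_im W γ₀ N) (levelDC_re_nonneg W γ₀ N) γ₀ DZf hDZf δ hδ hint
  refine le_trans (le_of_eq ?_) hmain
  congr 1
  have hfun : (fun p : torusFin W × torusFin' W =>
      (levelDC W γ₀ N ((((p.1 : torusT W) : GA W))⁻¹ * GA.ofFinPart W γ₀ * ((p.2 : torusT' W) : GA W))).re) =
      (suppSet W γ₀ N γ₀).indicator (fun _ => (1 : ℝ)) := by
    funext p
    by_cases hp : p ∈ suppSet W γ₀ N γ₀
    · rw [Set.indicator_of_mem hp, levelDC_of_mem W γ₀ N (orbit_mem_finitePart W γ₀ p.1 p.2) hp, Complex.one_re]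
    · rw [Set.indicator_of_notMem hp]
      have h0 : levelDC W γ₀ N ((((p.1 : torusT W) : GA W))⁻¹ * GA.ofFinPart W γ₀ * ((p.2 : torusT' W) : GA W)) = 0 := by
        by_contra h0
        exact hp (mem_levelDoubleCoset_of_levelDC_ne_zero W γ₀ N (orbit_mem_finitePart W γ₀ p.1 p.2) h0)
      rw [h0, Complex.zero_re]
  rw [hfun, integral_indicator (measurableSet_suppSet W γ₀ hN γ₀), Measure.restrict_restrict
    (measurableSet_suppSet W γ₀ hN γ₀), setIntegral_const, smul_eq_mul, measureReal_def, mul_one]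
  rfl

end Main

end Summit.Ventures.HodgeRepro.Tier4.Line4

end
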